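import Summits.RiemannHypothesis.RiemannHypothesis.Statement
import Literature.NumberTheory.LFunctions.LagariasDifferencedXi
import Literature.NumberTheory.DiophantineGeometry.NamedHypothesesRHProofs
import Literature.NumberTheory.LFunctions.ZetaRealAxis
import Summits.RiemannHypothesis.RiemannHypothesis.Theorems.CofiniteCriticalLine.Negative.HorizontalMonotonicity
import Summits.RiemannHypothesis.RiemannHypothesis.Theorems.Splittings.CostumeDetectorsHeight

/-!
# RiemannHypothesis / Splittings — costume detectors VII: the cosh/sinh-ROW family (Lagarias 2005) is
HEIGHT-TRANSPARENT; `E_cosh ⟺ RH` (RAW zero-definition form of cell rh-split, seat x-transfer gen 2)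

LABEL: SPLITTING SEARCH over kernel-typed RH-EQUIVALENCES; a splitting `A ∧ B ⟹ RH` is CONDITIONAL bookkeeping
unless `A` and `B` are both proved; nothing here bears on the truth of RH.  Raw form (typer-2 g2) of
`HOME/rh-split-x-transfer/SketchG2.lean` (sha16 e3dc782a7a4199d0; referee g2 replay 23:04Z std, content PRE-FILE PASS;
typer-2 H1 std): the Props `LocalRH/RHAbove/RowsUpTo/RowsAbove/Rows/RowsTailDetects` are WRITTEN OUT and §6's
named-fact parametrisation is discharged (theorems only).  Card: `cards/SPLIT-x-transfer.md` §9 v2.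

KERNEL content: §1 FE-pair identity (`ring`); §2 local RH at height `t` (window ½) ⟹ `‖ξ(h+1−s̄)‖ < ‖ξ(h+s)‖`
(`h > 0`, `Re s > ½`, `Im s = t`); §3 local Lagarias 2005 Lemma 2.2 ⟹ rows `A_{h,θ}`, `B_{h,θ}` clean AT HEIGHT `t`; §4 the exchange corollaries: `RiemannHypothesisUpTo (T + ½) ⟹`
rows clean up to `T` (HEAD), RH above `T − ½` ⟹ rows clean above `T` (TAIL ⟸), RH ⟹ all rows; §5 rows clean above `T`
⟹ RH above `T + 1` (`A_h → ξ` on closed balls + Hurwitz); §6 the relabelled split `rh_of_rhUpTo_of_rowsTail` =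
`rh_of_rhUpTo_zdTail` renamed (HEAD unused), the UNCONDITIONAL `rows_iff_rh : (∀ h > 0, ∀ θ, rows on the line) ↔ RH`
(E_cosh ⟺ RH), the sandwich RH above `T − ½` ⟹ rows above `T` ⟹ RH above `T + 1`.  Referee labels (23:04Z):
E_cosh RH-EQUIVALENT (kernel); FIN_rows RH-FREE ⟸ RH(T+½); TAIL_rows ≡ RHAbove ± 1 ⇒ RH-EQUIVALENT given FIN;
tautology test: P0 partition relabelled (FAIL-shape); class (γ) RELABELLING; 0 survivors.
-/

noncomputable section

set_option linter.dupNamespace false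

open Complex Set Filter Metric Topology
open scoped ComplexConjugate
open Literature.NumberTheory.LFunctions Literature.NumberTheory.DiophantineGeometry
open Summit.RiemannHypothesis.Cruxes.CofiniteCriticalLine.Negative
open Summit.RiemannHypothesis.RiemannHypothesis.Theorems.Splittings.CostumeDetectorsHeight (rh_of_rhUpTo_zdTail)

namespace Summit.RiemannHypothesis.RiemannHypothesis.Theorems.Splittings.CostumeDetectorsRows

/-! ## §1 The FE-pair identity (depth-`ω` refinement; documentation-grade kernel algebra) -/

/-- For `s = σ + it`, a shift `ω`, an FE-pair of zeros `β + iγ`, `(1−β) + iγ` and `d = t − γ`: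
`N − D = 8ω(σ−½)(d² + (σ−½)² + ω² − (β−½)²)`, `N = ((σ+ω−β)²+d²)((σ+ω−1+β)²+d²)` the pair's factor in `|ξ(s+ω)|²`,
`D` the same with `−ω`. -/
theorem fePair_identity (σ ω β d : ℝ) :
    ((σ + ω - β) ^ 2 + d ^ 2) * ((σ + ω - 1 + β) ^ 2 + d ^ 2) -
        ((σ - ω - β) ^ 2 + d ^ 2) * ((σ - ω - 1 + β) ^ 2 + d ^ 2) =
      8 * ω * (σ - 1 / 2) * (d ^ 2 + (σ - 1 / 2) ^ 2 + ω ^ 2 - (β - 1 / 2) ^ 2) := by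
  ring

/-- The `ω → 0` form: the numerator of the MSZ/Lagarias pair term (tree: `msz_pair_pos`). -/
theorem fePair_deriv_identity (σ β d : ℝ) :
    (σ - β) * ((σ - 1 + β) ^ 2 + d ^ 2) + (σ - 1 + β) * ((σ - β) ^ 2 + d ^ 2) =
      2 * (σ - 1 / 2) * ((σ - 1 / 2) ^ 2 + d ^ 2 - (β - 1 / 2) ^ 2) := by
  ring

/-- Outside the disc of influence `d² + (σ−½)² + ω² > (β−½)²` (and `σ > ½`, `ω > 0`) the pair favours the
deeper shift: `D < N`. -/
theorem fePair_lt {σ ω β d : ℝ} (hω : 0 < ω) (hσ : 1 / 2 < σ)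
    (hK : (β - 1 / 2) ^ 2 < d ^ 2 + (σ - 1 / 2) ^ 2 + ω ^ 2) :
    ((σ - ω - β) ^ 2 + d ^ 2) * ((σ - ω - 1 + β) ^ 2 + d ^ 2) <
      ((σ + ω - β) ^ 2 + d ^ 2) * ((σ + ω - 1 + β) ^ 2 + d ^ 2) := by
  have h8 : 0 < 8 * ω * (σ - 1 / 2) * (d ^ 2 + (σ - 1 / 2) ^ 2 + ω ^ 2 - (β - 1 / 2) ^ 2) :=
    mul_pos (mul_pos (mul_pos (by norm_num) hω) (by linarith)) (by linarith)
  rw [← sub_pos, fePair_identity]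
  exact h8

/-- A self-paired on-line zero always favours the deeper shift. -/
theorem online_term_lt {u ω d : ℝ} (hu : 0 < u) (hω : 0 < ω) :
    (u - ω) ^ 2 + d ^ 2 < (u + ω) ^ 2 + d ^ 2 := by
  nlinarith [mul_pos hu hω]

/-- The disc of influence has radius `< ½` in height: zeros at height distance `≥ ½` never obstruct. -/
theorem influence_lt_of_far {σ ω β d : ℝ} (hβ0 : 0 < β) (hβ1 : β < 1)
    (hd : 1 / 2 ≤ |d|) : (β - 1 / 2) ^ 2 < d ^ 2 + (σ - 1 / 2) ^ 2 + ω ^ 2 := by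
  have h1 : (β - 1 / 2) ^ 2 < (1 / 2) ^ 2 := by nlinarith
  have h2 : (1 / 2 : ℝ) ^ 2 ≤ d ^ 2 := by
    calc (1 / 2 : ℝ) ^ 2 ≤ |d| ^ 2 := by gcongr
      _ = d ^ 2 := sq_abs _
  nlinarith [sq_nonneg (σ - 1 / 2), sq_nonneg ω]

/-- Rows `ω ≥ ½`: the disc condition is automatic (`|β − ½| < ½ ≤ ω`) — Lagarias 2005 Lemma 2.1 (1) regime. -/
theorem influence_lt_of_half_le {σ ω β d : ℝ} (hβ0 : 0 < β) (hβ1 : β < 1) (hω : 1 / 2 ≤ ω) :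
    (β - 1 / 2) ^ 2 < d ^ 2 + (σ - 1 / 2) ^ 2 + ω ^ 2 := by
  have h1 : (β - 1 / 2) ^ 2 < (1 / 2) ^ 2 := by nlinarith
  have h2 : (1 / 2 : ℝ) ^ 2 ≤ ω ^ 2 := by gcongr
  nlinarith [sq_nonneg (σ - 1 / 2), sq_nonneg d]

/-- Depth `≤ ω` zeros never obstruct off the line. -/
theorem influence_lt_of_depth {σ ω β d : ℝ} (hσ : σ ≠ 1 / 2) (hdepth : |β - 1 / 2| ≤ ω) :
    (β - 1 / 2) ^ 2 < d ^ 2 + (σ - 1 / 2) ^ 2 + ω ^ 2 := by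
  have h1 : (β - 1 / 2) ^ 2 ≤ ω ^ 2 := by
    calc (β - 1 / 2) ^ 2 = |β - 1 / 2| ^ 2 := (sq_abs _).symm
      _ ≤ ω ^ 2 := by gcongr
  have h2 : 0 < (σ - 1 / 2) ^ 2 := by
    have : σ - 1 / 2 ≠ 0 := sub_ne_zero.2 hσ
    positivity
  nlinarith [sq_nonneg d]

/-! ## §2 The local shift inequality at depth 0 (KERNEL) -/

/-- Under local RH at height `t`, `|ξ|` is strictly increasing along the ray `[½, ∞) + it`
(tree: MSZ criterion + horizontal monotonicity), in two-point form. -/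
theorem norm_riemannXi_lt_of_localRH {t : ℝ} (hloc : (∀ ρ : ℂ, riemannZeta ρ = 0 → 0 < ρ.re → ρ.re < 1 → ρ.re ≠ 1 / 2 → 1 / 2 ≤ |t - ρ.im|)) {w z : ℂ} (hw : 1 / 2 ≤ w.re)
    (hwz : w.re < z.re) (hwi : w.im = t) (hzi : z.im = t) : ‖riemannXi w‖ < ‖riemannXi z‖ := by
  have hmono := strictMonoOn_norm_riemannXi_of_re_logDeriv_pos (t := t)
    (fun σ hσ => re_logDeriv_riemannXi_pos_of_offLine_height hσ hloc)
  have ew : w = (w.re : ℂ) + t * I := Complex.ext (by simp) (by simp [hwi])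
  have ez : z = (z.re : ℂ) + t * I := Complex.ext (by simp) (by simp [hzi])
  have key : ‖riemannXi ((w.re : ℂ) + t * I)‖ < ‖riemannXi ((z.re : ℂ) + t * I)‖ :=
    hmono (show w.re ∈ Ici (1 / 2 : ℝ) from hw) (show z.re ∈ Ici (1 / 2 : ℝ) from le_trans hw hwz.le) hwz
  rw [← ew, ← ez] at key
  exact key

/-- **Local shift inequality** (the height-local form of Lagarias 2005 Lemma 2.1 (2)): under local RH at height
`t = Im s`, for every `h > 0` and `Re s > ½`, `‖ξ(h + 1 − s̄)‖ < ‖ξ(h + s)‖` (`= ‖ξ(s − h)‖ < ‖ξ(s + h)‖`). -/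
theorem shift_reflect_lt_of_localRH {t : ℝ} (hloc : (∀ ρ : ℂ, riemannZeta ρ = 0 → 0 < ρ.re → ρ.re < 1 → ρ.re ≠ 1 / 2 → 1 / 2 ≤ |t - ρ.im|)) {h : ℝ} (hh : 0 < h) {s : ℂ}
    (hs : 1 / 2 < s.re) (hst : s.im = t) :
    ‖riemannXi ((h : ℂ) + 1 - conj s)‖ < ‖riemannXi ((h : ℂ) + s)‖ := by
  by_cases hc : 1 / 2 ≤ h + 1 - s.re
  · exact norm_riemannXi_lt_of_localRH hloc (by simpa using hc) (by simp; linarith) (by simp [hst])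
      (by simp [hst])
  · push Not at hc
    have e1 : riemannXi ((h : ℂ) + 1 - conj s) = conj (riemannXi (s - h)) := by
      have e0 : (h : ℂ) + 1 - conj s = 1 - conj (s - h) := by
        simp only [map_sub, Complex.conj_ofReal]; ring
      rw [e0, riemannXi_one_sub, riemannXi_conj_holds (s - h)]
    rw [e1, Complex.norm_conj]
    exact norm_riemannXi_lt_of_localRH hloc (by simp; linarith) (by simp; linarith) (by simp [hst])
      (by simp [hst])

/-! ## §3 Local form of Lagarias 2005 Lemma 2.2: rows clean AT HEIGHT `t` (KERNEL) -/

/-- Local Lemma 2.2 (first conclusion): if `‖E(1 − s̄)‖ < ‖E(s)‖` for all `s` with `Re s > ½` AT HEIGHT `t`,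
then `A = critRePart E` and `B = critImPart E` do not vanish off the line at height `t`
(the printed three-line argument of `lagarias2005_lemma_2_2_zeros`, localised). -/
theorem critParts_ne_zero_at_height {E : ℂ → ℂ} {t : ℝ}
    (hE : ∀ s : ℂ, 1 / 2 < s.re → s.im = t → ‖E (1 - conj s)‖ < ‖E s‖) {s : ℂ} (hst : s.im = t)
    (hs : s.re ≠ 1 / 2) : critRePart E s ≠ 0 ∧ critImPart E s ≠ 0 := by
  have hne : ‖E s‖ ≠ ‖critReflect E s‖ := by
    rw [critReflect_apply, Complex.norm_conj]
    rcases lt_or_gt_of_ne hs with h | h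
    · have h' : (1 / 2 : ℝ) < (1 - conj s).re := by simp; linarith
      have h'' : (1 - conj s).im = t := by simp [hst]
      have := hE _ h' h''
      have e : (1 : ℂ) - conj (1 - conj s) = s := by simp
      rw [e] at this
      exact this.ne
    · exact (hE s h hst).ne'
  constructor
  · intro h0
    apply hne
    have : E s = -critReflect E s := by
      rw [critRePart] at h0
      linear_combination 2 * h0
    rw [this, norm_neg]
  · intro h0
    apply hne
    have : E s = critReflect E s := by
      rw [critImPart] at h0
      have h2 : I * (E s - critReflect E s) = 0 := by
        linear_combination 2 * h0
      rcases mul_eq_zero.1 h2 with hI | h3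
      · exact absurd hI I_ne_zero
      · exact sub_eq_zero.1 h3
    rw [this]

/-- **Rows clean at height `t`**: under local RH at height `t`, for every `h > 0` and every `θ`, the Lagarias
rows `A_{h,θ}`, `B_{h,θ}` (all `ξ(s+h) + c ξ(s−h)`, `|c| = 1`) have no zero off the critical line at height `t`. -/
theorem rows_clean_of_localRH {t : ℝ} (hloc : (∀ ρ : ℂ, riemannZeta ρ = 0 → 0 < ρ.re → ρ.re < 1 → ρ.re ≠ 1 / 2 → 1 / 2 ≤ |t - ρ.im|)) {h : ℝ} (hh : 0 < h) (θ : ℝ) {s : ℂ}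
    (hst : s.im = t) :
    (diffXiArot h θ s = 0 → s.re = 1 / 2) ∧ (diffXiBrot h θ s = 0 → s.re = 1 / 2) := by
  have hE : ∀ w : ℂ, 1 / 2 < w.re → w.im = t →
      ‖diffXiErot h θ (1 - conj w)‖ < ‖diffXiErot h θ w‖ := by
    intro w hw hwt
    have key := shift_reflect_lt_of_localRH hloc hh hw hwt
    have e1 : (1 : ℂ) - conj w + h = h + 1 - conj w := by ring
    have e2 : w + (h : ℂ) = h + w := by ring
    have h1 : ‖cexp (θ * I)‖ = 1 := by rw [Complex.norm_exp]; simp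
    simp only [diffXiErot, e1, e2, norm_mul, h1, one_mul]
    exact key
  by_cases hs : s.re = 1 / 2
  · exact ⟨fun _ => hs, fun _ => hs⟩
  · have hne := critParts_ne_zero_at_height hE hst hs
    rw [← diffXiArot_eq_critRePart, ← diffXiBrot_eq_critImPart] at hne
    exact ⟨fun h0 => absurd h0 hne.1, fun h0 => absurd h0 hne.2⟩

/-! ## §4 Height bookkeeping: the exchange corollaries (KERNEL) -/

/-- The row family splits at any height `T` into HEAD (rows clean up to `T`) and TAIL (clean above `T`). -/
theorem rows_iff_upTo_above (T : ℝ) : (∀ h θ : ℝ, 0 < h → AllZerosOnCriticalLine (diffXiArot h θ) ∧ AllZerosOnCriticalLine (diffXiBrot h θ)) ↔ (∀ h θ : ℝ, 0 < h → ∀ s : ℂ, |s.im| ≤ T →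
      (diffXiArot h θ s = 0 → s.re = 1 / 2) ∧ (diffXiBrot h θ s = 0 → s.re = 1 / 2)) ∧ (∀ h θ : ℝ, 0 < h → ∀ s : ℂ, T < |s.im| →
      (diffXiArot h θ s = 0 → s.re = 1 / 2) ∧ (diffXiBrot h θ s = 0 → s.re = 1 / 2)) := by
  constructor
  · intro hR
    exact ⟨fun h θ hh s _ => ⟨(hR h θ hh).1 s, (hR h θ hh).2 s⟩,
      fun h θ hh s _ => ⟨(hR h θ hh).1 s, (hR h θ hh).2 s⟩⟩
  · rintro ⟨hU, hA⟩ h θ hh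
    refine ⟨fun s hs => ?_, fun s hs => ?_⟩
    · by_cases hT : |s.im| ≤ T
      · exact (hU h θ hh s hT).1 hs
      · exact (hA h θ hh s (lt_of_not_ge hT)).1 hs
    · by_cases hT : |s.im| ≤ T
      · exact (hU h θ hh s hT).2 hs
      · exact (hA h θ hh s (lt_of_not_ge hT)).2 hs

/-- RH up to height `T + ½` gives local RH at every height `|t| ≤ T`. -/
theorem localRH_of_rhUpTo {T : ℝ} (hRH : RiemannHypothesisUpTo (T + 1 / 2)) {t : ℝ} (ht : |t| ≤ T) :
    (∀ ρ : ℂ, riemannZeta ρ = 0 → 0 < ρ.re → ρ.re < 1 → ρ.re ≠ 1 / 2 → 1 / 2 ≤ |t - ρ.im|) := by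
  intro ρ hz h0 h1 hne
  by_contra hlt
  push Not at hlt
  apply hne
  have hρT : |ρ.im| ≤ T + 1 / 2 := by
    have := abs_sub_abs_le_abs_sub ρ.im t
    rw [abs_sub_comm] at hlt
    linarith
  rcases lt_trichotomy ρ.im 0 with hneg | hzero | hpos
  · exact hRH.re_eq_of_im_neg hz hneg (by rw [abs_of_neg hneg] at hρT; exact hρT)
  · exact absurd hz (riemannZeta_ne_zero_of_im_eq_zero_of_pos_of_lt_one hzero h0 h1)
  · exact hRH ρ hz hpos (by rw [abs_of_pos hpos] at hρT; exact hρT)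

/-- **Exchange lemma, HEAD** (lossless calibration `T ↦ T − ½`): RH up to height `T + ½` ⟹ EVERY row
`A_{h,θ}`, `B_{h,θ}`, `h > 0`, is clean up to height `T`. With F1 (Platt–Trudgian, `RiemannHypothesisUpTo
3·10¹²`) the whole head of the family is certified at once. -/
theorem rowsUpTo_of_rhUpTo {T : ℝ} (hRH : RiemannHypothesisUpTo (T + 1 / 2)) : (∀ h θ : ℝ, 0 < h → ∀ s : ℂ, |s.im| ≤ T →
      (diffXiArot h θ s = 0 → s.re = 1 / 2) ∧ (diffXiBrot h θ s = 0 → s.re = 1 / 2)) :=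
  fun _h θ hh _s hs => rows_clean_of_localRH (localRH_of_rhUpTo hRH hs) hh θ rfl

/-- RH above height `T − ½` gives local RH at every height `|t| > T`. -/
theorem localRH_of_rhAbove {T : ℝ} (hRH : (∀ s : ℂ, riemannZeta s = 0 → 0 < s.im → (T - 1 / 2) < s.im → s.re = 1 / 2)) {t : ℝ} (ht : T < |t|) : (∀ ρ : ℂ, riemannZeta ρ = 0 → 0 < ρ.re → ρ.re < 1 → ρ.re ≠ 1 / 2 → 1 / 2 ≤ |t - ρ.im|) := by
  intro ρ hz h0 h1 hne
  by_contra hlt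
  push Not at hlt
  apply hne
  have hρT : T - 1 / 2 < |ρ.im| := by
    have := abs_sub_abs_le_abs_sub t ρ.im
    linarith
  rcases lt_trichotomy ρ.im 0 with hneg | hzero | hpos
  · have := hRH (conj ρ) (riemannZeta_conj_eq_zero hz) (by simpa using hneg)
      (by rw [abs_of_neg hneg] at hρT; simpa using hρT)
    simpa using this
  · exact absurd hz (riemannZeta_ne_zero_of_im_eq_zero_of_pos_of_lt_one hzero h0 h1)
  · exact hRH ρ hz hpos (by rw [abs_of_pos hpos] at hρT; exact hρT)

/-- **Exchange lemma, TAIL ⟸**: RH above height `T − ½` ⟹ every row clean above height `T`. -/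
theorem rowsAbove_of_rhAbove {T : ℝ} (hRH : (∀ s : ℂ, riemannZeta s = 0 → 0 < s.im → (T - 1 / 2) < s.im → s.re = 1 / 2)) : (∀ h θ : ℝ, 0 < h → ∀ s : ℂ, T < |s.im| →
      (diffXiArot h θ s = 0 → s.re = 1 / 2) ∧ (diffXiBrot h θ s = 0 → s.re = 1 / 2)) :=
  fun _h θ hh _s hs => rows_clean_of_localRH (localRH_of_rhAbove hRH hs) hh θ rfl

/-- RH ⟹ all rows (= tree: `diffXiErot_critHB_rh` + `lagarias2005_lemma_2_2_zeros`, Lagarias 2005 Thm 2.1 (2)). -/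
theorem rows_of_rh (hRH : _root_.RiemannHypothesis) : (∀ h θ : ℝ, 0 < h → AllZerosOnCriticalLine (diffXiArot h θ) ∧ AllZerosOnCriticalLine (diffXiBrot h θ)) := by
  intro h θ hh
  have key := lagarias2005_lemma_2_2_zeros (diffXiErot_critHB_rh hRH hh θ)
  refine ⟨fun s hs => key.1 s ?_, fun s hs => key.2 s ?_⟩
  · rwa [← diffXiArot_eq_critRePart]
  · rwa [← diffXiBrot_eq_critImPart]

/-! ## §5 TAIL ⟹ RH above: `A_h → ξ` and Hurwitz (KERNEL) -/

/-- `A_h → ξ` uniformly on every closed ball along `h_n = 1/(n+1)` (uniform continuity of `ξ` on a compact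
neighbourhood). -/
theorem tendstoUniformlyOn_diffXiA (z₀ : ℂ) (r : ℝ) :
    TendstoUniformlyOn (fun (n : ℕ) (z : ℂ) => diffXiA (1 / ((n : ℝ) + 1)) z) riemannXi atTop
      (closedBall z₀ r) := by
  rw [Metric.tendstoUniformlyOn_iff]
  intro ε hε
  have huc : UniformContinuousOn riemannXi (closedBall z₀ (r + 1)) :=
    (isCompact_closedBall z₀ (r + 1)).uniformContinuousOn_of_continuous
      differentiable_riemannXi.continuous.continuousOn
  obtain ⟨δ, hδ, hδε⟩ := Metric.uniformContinuousOn_iff.1 huc ε hε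
  have hev : ∀ᶠ n : ℕ in atTop, 1 / ((n : ℝ) + 1) < δ :=
    tendsto_one_div_add_atTop_nhds_zero_nat.eventually (Iio_mem_nhds hδ)
  filter_upwards [hev] with n hn z hz
  show dist (riemannXi z) (diffXiA (1 / ((n : ℝ) + 1)) z) < ε
  have h0 : (0 : ℝ) < 1 / ((n : ℝ) + 1) := by positivity
  have h1 : 1 / ((n : ℝ) + 1) ≤ 1 := by
    rw [div_le_one (by positivity)]
    linarith [(Nat.cast_nonneg n : (0 : ℝ) ≤ n)]
  set h : ℝ := 1 / ((n : ℝ) + 1) with hh_def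
  have hnorm : ‖(h : ℂ)‖ = h := by rw [Complex.norm_real, Real.norm_eq_abs, abs_of_pos h0]
  have hz' : z ∈ closedBall z₀ (r + 1) := closedBall_subset_closedBall (by linarith) hz
  have hmem : ∀ w : ℂ, ‖w - z‖ ≤ 1 → w ∈ closedBall z₀ (r + 1) := by
    intro w hw
    rw [mem_closedBall, dist_eq_norm] at hz ⊢
    calc ‖w - z₀‖ = ‖(w - z) + (z - z₀)‖ := by ring_nf
      _ ≤ ‖w - z‖ + ‖z - z₀‖ := norm_add_le _ _
      _ ≤ 1 + r := add_le_add hw hz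
      _ = r + 1 := add_comm _ _
  have hp : ‖(z + h) - z‖ = h := by rw [show z + (h : ℂ) - z = (h : ℂ) by ring, hnorm]
  have hm : ‖(z - h) - z‖ = h := by rw [show z - (h : ℂ) - z = -(h : ℂ) by ring, norm_neg, hnorm]
  have e1 : dist (riemannXi (z + h)) (riemannXi z) < ε :=
    hδε (z + h) (hmem _ (by rw [hp]; exact h1)) z hz' (by rw [dist_eq_norm, hp]; exact hn)
  have e2 : dist (riemannXi (z - h)) (riemannXi z) < ε :=
    hδε (z - h) (hmem _ (by rw [hm]; exact h1)) z hz' (by rw [dist_eq_norm, hm]; exact hn)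
  rw [dist_eq_norm, norm_sub_rev] at e1 e2
  rw [dist_eq_norm]
  have e : riemannXi z - diffXiA h z =
      ((riemannXi z - riemannXi (z + h)) + (riemannXi z - riemannXi (z - h))) / 2 := by
    rw [diffXiA]; ring
  rw [e, norm_div, Complex.norm_two]
  have := norm_add_le (riemannXi z - riemannXi (z + h)) (riemannXi z - riemannXi (z - h))
  linarith

/-- **Rows clean above height `T` ⟹ RH above height `T + 1`** (KERNEL; Hurwitz, tree
`Complex.eventually_exists_zero_mem_ball_of_tendstoUniformlyOn`): at an off-line zero `ρ₀` of `ξ` with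
`Im ρ₀ > T + 1`, some `A_h`, `h = 1/(n+1)`, has a zero within `min(|Re ρ₀ − ½|, 1)/2` of `ρ₀`. -/
theorem rhAbove_of_rowsAbove (T : ℝ) (hA : (∀ h θ : ℝ, 0 < h → ∀ s : ℂ, T < |s.im| →
      (diffXiArot h θ s = 0 → s.re = 1 / 2) ∧ (diffXiBrot h θ s = 0 → s.re = 1 / 2))) : (∀ s : ℂ, riemannZeta s = 0 → 0 < s.im → (T + 1) < s.im → s.re = 1 / 2) := by
  intro s hz him hT
  by_contra hs
  obtain ⟨h0, h1⟩ := re_mem_Ioo_of_riemannZeta_eq_zero_of_im_ne_zero hz him.ne'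
  have hξ : riemannXi s = 0 := (riemannXi_eq_zero_iff_holds s).2 ⟨hz, h0, h1⟩
  have han : AnalyticAt ℂ riemannXi s := differentiable_riemannXi.analyticAt s
  rcases han.eventually_eq_zero_or_eventually_ne_zero with hzero | hne
  · -- `ξ ≡ 0` near `s` would force `ξ ≡ 0`, but `ξ(2) ≠ 0`
    have hON : AnalyticOnNhd ℂ riemannXi univ :=
      differentiable_riemannXi.differentiableOn.analyticOnNhd isOpen_univ
    have h2 := hON.eqOn_zero_of_preconnected_of_eventuallyEq_zero isPreconnected_univ (mem_univ s) hzero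
      (mem_univ (2 : ℂ))
    have h2' := ((riemannXi_eq_zero_iff_holds 2).1 h2).2.2
    norm_num at h2'
  · obtain ⟨r₀, hr₀, hball⟩ : ∃ r₀ > 0, ∀ z ∈ ball s r₀, z ≠ s → riemannXi z ≠ 0 :=
      Metric.eventually_nhds_iff_ball.1 ((eventually_nhdsWithin_iff.1 hne).mono fun z hz hzs => hz hzs)
    have hsre : 0 < |s.re - 1 / 2| := abs_pos.2 (sub_ne_zero.2 hs)
    set r : ℝ := min (r₀ / 2) (min (|s.re - 1 / 2| / 2) (1 / 2)) with hr_def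
    have hr : 0 < r := lt_min (by linarith) (lt_min (by linarith) (by norm_num))
    have hr1 : r ≤ r₀ / 2 := min_le_left _ _
    have hr2 : r ≤ |s.re - 1 / 2| / 2 := le_trans (min_le_right _ _) (min_le_left _ _)
    have hr3 : r ≤ 1 / 2 := le_trans (min_le_right _ _) (min_le_right _ _)
    have hsphere : ∀ z ∈ sphere s r, riemannXi z ≠ 0 := by
      intro z hz'
      have hzs : dist z s = r := hz'
      refine hball z (mem_ball.2 (by linarith)) ?_
      intro hzs'
      rw [hzs', dist_self] at hzs
      linarith
    have hF : ∀ᶠ n : ℕ in atTop,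
        DiffContOnCl ℂ ((fun (n : ℕ) (z : ℂ) => diffXiA (1 / ((n : ℝ) + 1)) z) n) (ball s r) :=
      Filter.Eventually.of_forall fun n => (differentiable_diffXiA _).diffContOnCl
    have hcont : ContinuousOn riemannXi (sphere s r) := differentiable_riemannXi.continuous.continuousOn
    have hev := Complex.eventually_exists_zero_mem_ball_of_tendstoUniformlyOn hr hF
      (tendstoUniformlyOn_diffXiA s r) hcont hξ hsphere
    obtain ⟨n, z, hzball, hzero⟩ := hev.exists
    have hzero' : diffXiA (1 / ((n : ℝ) + 1)) z = 0 := hzero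
    have hpos : (0 : ℝ) < 1 / ((n : ℝ) + 1) := by positivity
    have hdist : ‖z - s‖ < r := by rw [← dist_eq_norm]; exact mem_ball.1 hzball
    have hre : |z.re - s.re| < r := by
      have := Complex.abs_re_le_norm (z - s)
      rw [Complex.sub_re] at this
      linarith
    have him' : |z.im - s.im| < r := by
      have := Complex.abs_im_le_norm (z - s)
      rw [Complex.sub_im] at this
      linarith
    have hzT : T < |z.im| := by
      have h3 := (abs_lt.1 him').1
      exact lt_of_lt_of_le (by linarith) (le_abs_self _)
    have hA0 : diffXiArot (1 / ((n : ℝ) + 1)) 0 z = 0 := by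
      rw [diffXiArot, Real.cos_zero, Real.sin_zero, hzero']
      simp
    have hzre := (hA (1 / ((n : ℝ) + 1)) 0 hpos z hzT).1 hA0
    rw [hzre, abs_sub_comm] at hre
    linarith

/-! ## §6 The relabelled split and `E_cosh ⟺ RH` (KERNEL, unconditional) -/

/-- **The cosh height split is the zd split relabelled**: F1-type head `RiemannHypothesisUpTo (T+1)` and the
row tail above `T` give RH, through `rh_of_rhUpTo_zdTail` verbatim (the row HEAD is not even used). -/
theorem rh_of_rhUpTo_of_rowsTail {T : ℝ} (hF : RiemannHypothesisUpTo (T + 1))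
    (hTail : (∀ h θ : ℝ, 0 < h → ∀ s : ℂ, T < |s.im| →
      (diffXiArot h θ s = 0 → s.re = 1 / 2) ∧ (diffXiBrot h θ s = 0 → s.re = 1 / 2))) : _root_.RiemannHypothesis :=
  rh_of_rhUpTo_zdTail (T + 1) hF (rhAbove_of_rowsAbove T hTail)

/-- TAIL_rows(T) ⟸ RH (cheap direction). -/
theorem rowsAbove_of_rh (hRH : _root_.RiemannHypothesis) (T : ℝ) : (∀ h θ : ℝ, 0 < h → ∀ s : ℂ, T < |s.im| →
      (diffXiArot h θ s = 0 → s.re = 1 / 2) ∧ (diffXiBrot h θ s = 0 → s.re = 1 / 2)) :=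
  ((rows_iff_upTo_above T).1 (rows_of_rh hRH)).2

/-- **`E_cosh ⟺ RH`, unconditional**: every row `A_{h,θ}`, `B_{h,θ}` (`h > 0`) of the cosh family has all its
zeros on the critical line iff RH. -/
theorem rows_iff_rh : (∀ h θ : ℝ, 0 < h → AllZerosOnCriticalLine (diffXiArot h θ) ∧ AllZerosOnCriticalLine (diffXiBrot h θ)) ↔ _root_.RiemannHypothesis := by
  refine ⟨fun hR => ?_, rows_of_rh⟩
  have hA : (∀ h θ : ℝ, 0 < h → ∀ s : ℂ, (-1) < |s.im| →
      (diffXiArot h θ s = 0 → s.re = 1 / 2) ∧ (diffXiBrot h θ s = 0 → s.re = 1 / 2)) := ((rows_iff_upTo_above (-1)).1 hR).2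
  have h0 : (∀ s : ℂ, riemannZeta s = 0 → 0 < s.im → ((-1 : ℝ) + 1) < s.im → s.re = 1 / 2) := rhAbove_of_rowsAbove (-1) hA
  have hF : RiemannHypothesisUpTo ((-1 : ℝ) + 1) := fun s _ h0' h1' => by norm_num at h1'; linarith
  exact rh_of_rhUpTo_zdTail ((-1 : ℝ) + 1) hF h0

/-- TAIL_rows(T) sandwiched between zd tails: `RHAbove (T − ½) ⟹ RowsAbove T ⟹ RHAbove (T + 1)`. -/
theorem rowsAbove_sandwich (T : ℝ) :
    ((∀ s : ℂ, riemannZeta s = 0 → 0 < s.im → (T - 1 / 2) < s.im → s.re = 1 / 2) → (∀ h θ : ℝ, 0 < h → ∀ s : ℂ, T < |s.im| →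
      (diffXiArot h θ s = 0 → s.re = 1 / 2) ∧ (diffXiBrot h θ s = 0 → s.re = 1 / 2))) ∧ ((∀ h θ : ℝ, 0 < h → ∀ s : ℂ, T < |s.im| →
      (diffXiArot h θ s = 0 → s.re = 1 / 2) ∧ (diffXiBrot h θ s = 0 → s.re = 1 / 2)) → (∀ s : ℂ, riemannZeta s = 0 → 0 < s.im → (T + 1) < s.im → s.re = 1 / 2)) :=
  ⟨rowsAbove_of_rhAbove, rhAbove_of_rowsAbove T⟩

end Summit.RiemannHypothesis.RiemannHypothesis.Theorems.Splittings.CostumeDetectorsRows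

end
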